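import Summits.CriticalPhenomena.PercolationContinuityZ3.Theorems.PercNearOneGluingAdditiveGluingSetObserverLevelForms
import Summits.CriticalPhenomena.PercolationContinuityZ3.Theorems.PercNearOneGluingAdditiveGluingSetObserverDefect
import Summits.CriticalPhenomena.PercolationContinuityZ3.Theorems.PercNearOneGluingNoHeavyLowerTailMixCSHUnfoldTools
import HarnessLib

/-!
# Conjecture G / SET-W via a SET observer, XIII: world indicators of a decoy with a set-observer slot, and the slot moments of the residual

Support file (`--supports stmt-CriticalPhenomena-4576`); no definitions, no named facts, no sorries.  Seat (b) V⁺-form `png-dp-vplus`, gen 13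
(memo MEMO-gen12.md §4(b),(c), §10 (U)).  Set-slot version of the first half of prim-ineq-prove-1's `…NoHeavyLowerTailCSHUnfoldDecoy.lean`
(sum level, `BHK2006.weight`, worlds = delete the pairs meeting `Y ∪ V(C_Y(ω))`), in the vocabulary `CSHSet.chiO / slotEv / obsEv` (decoy `d`,
source set `S`, later decoys `L'` — vertex slots —, set observer `O ∌ d`, liveness factor `ℓ(C_Y) = 1{∀ o ∈ O, o ↮ Y}`):
* `chiO_world_none` — in a live world the set-slot indicator `ℓ·1{O ~ d}·1{O ≁ S}` read in the world is the GLOBAL event `obsEv O d (S ∪ Y)`;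
* `world_term_alive_set` / `world_term_dead_set` — alive decoys have global indicators, dead decoys give a configuration-free term;
  (the Markov merge at `C_Y` for a world-dependent test function is prim seat MixCSH's `MixCSH.markov_merge_Y₂`, imported);
* `sum_resid_slot_moment_le` — the centred moment of the residual `Θ` against a slot indicator is EQUAL to `−m₀⁻¹(m₀P₁ − m₁P₀)` on a vertex slot
  (`CSH.sum_resid_decoy_moment`) and AT MOST it on the set slot (the defect lemma `CSH.sum_resid_obs_le`, gen 12).
[cite: VandenbergHaggstromKahn2005, §2.1 Lemma 2.4 (p. 10); §1 display (10) (pp. 7–8) — corollaries] [cite: KozmaNitzan2024, Conj. 4 (p. 32)]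
-/

noncomputable section

namespace Summit.CriticalPhenomena.PercolationContinuityZ3.Theorems

open MeasureTheory Set Literature.Probability.LatticeModels Literature.Probability.Percolation
open scoped Classical

namespace CSHSet

open CSH HullPort BHK2006 DecisionTree

variable {V : Type*}

/-! ### The liveness factor of a world and the set-slot indicator in a world -/

/-- **The set-slot indicator read in a live world is the global observer event**: for the world `ζ' = ζ ∖ cut_Y ζ` with liveness factor
`ℓ = 1{∀ o ∈ O, o ↮ Y}(ζ)`, `chiO_{S,d}(none) = ℓ · 1{(∃ o, o ↔ d in ζ') ∧ (∀ o, ∀ s ∈ S, o ↮ s in ζ')} = 1_{obsEv O d (S ∪ Y)}(ζ)` (on a live world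
the observers avoid `Y`, so their connections in the world are their global connections, `CSH.reachable_sdiff_cut_iff_of_avoid`). [folklore] -/
theorem chiO_world_none (O : Finset V) (Y S : Set V) (d : V) (ζ : Set (Sym2 V)) :
    chiO (openGraph (ζ \ cut Y ζ)).Reachable O (ind {ζ' : Set (Sym2 V) | ∀ o ∈ O, ζ' ∈ avoidEv o Y} ζ) S d none =
      ind (obsEv O d (S ∪ Y)) ζ := by
  rw [chiO_none]
  by_cases hl : ζ ∈ {ζ' : Set (Sym2 V) | ∀ o ∈ O, ζ' ∈ avoidEv o Y}
  · have hav : ∀ o ∈ O, ζ ∈ avoidEv o Y := hl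
    rw [ind_of_mem hl, one_mul]
    have key : ((∃ o ∈ O, (openGraph (ζ \ cut Y ζ)).Reachable o d) ∧
        (∀ o ∈ O, ∀ s ∈ S, ¬ (openGraph (ζ \ cut Y ζ)).Reachable o s)) ↔ ζ ∈ obsEv O d (S ∪ Y) := by
      constructor
      · rintro ⟨⟨o, ho, hod⟩, h2⟩
        refine ⟨⟨o, ho, (reachable_sdiff_cut_iff_of_avoid (hav o ho) d).1 hod⟩, fun o ho a ha => ?_⟩
        rcases ha with ha | ha
        · exact fun h => h2 o ho a ha ((reachable_sdiff_cut_iff_of_avoid (hav o ho) a).2 h)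
        · exact hav o ho a ha
      · rintro ⟨⟨o, ho, hod⟩, h2⟩
        exact ⟨⟨o, ho, (reachable_sdiff_cut_iff_of_avoid (hav o ho) d).2 hod⟩,
          fun o ho s hs h => h2 o ho s (Or.inl hs) ((reachable_sdiff_cut_iff_of_avoid (hav o ho) s).1 h)⟩
    by_cases h : ζ ∈ obsEv O d (S ∪ Y)
    · rw [ind_of_mem h, if_pos (key.2 h)]
    · rw [ind_of_not_mem h, if_neg (fun h' => h (key.1 h'))]
  · rw [ind_of_not_mem hl, zero_mul]
    have h : ζ ∉ obsEv O d (S ∪ Y) := by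
      rintro ⟨-, h2⟩
      exact hl fun o ho y hy => h2 o ho y (Or.inr hy)
    rw [ind_of_not_mem h]

/-! ### The world test function of one decoy: alive (outside `C_Y`) and dead (inside `C_Y`) -/

/-- Alive decoy: the world term `ε(d)·sl_{L'}[chiO_d − c](s)` equals `1{d ↮ S}(ζ) · sl_{L'}[s' ↦ 1_{slotEv O d (S∪Y) s'}(ζ) − c s'](s)` (global
indicators; liveness factor `ℓ(C_Y(ζ)) = 1{∀ o ∈ O, o ↮ Y}(ζ)`). (transcription of the cell memo png-dp-vplus MEMO-gen12.md §4(b)) [folklore] -/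
theorem world_term_alive_set {ζ : Set (Sym2 V)} {Y : Set V} {d : V} (h : ζ ∈ avoidEv d Y) (O : Finset V) (S : Set V)
    (ℓ : Set (Sym2 V) → ℝ) (hℓ : ∀ ζ' : Set (Sym2 V), ℓ (setCl ζ' Y) = ind {β : Set (Sym2 V) | ∀ o ∈ O, β ∈ avoidEv o Y} ζ')
    (L' : List (Option V × (Option V → ℝ))) (c : Option V → ℝ) (s : Option V) :
    av (openGraph (ζ \ cut Y ζ)).Reachable S d *
        slForm L' (fun s' => chiO (openGraph (ζ \ cut Y ζ)).Reachable O (ℓ (setCl ζ Y)) S d s' - c s') s =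
      ind (avoidEv d S) ζ * slForm L' (fun s' => ind (slotEv O d (S ∪ Y) s') ζ - c s') s := by
  have hav : av (openGraph (ζ \ cut Y ζ)).Reachable S d = ind (avoidEv d S) ζ := by
    rw [← av_reachable_eq_ind ζ S d]
    unfold CSH.av
    have : (∀ s ∈ S, ¬ (openGraph (ζ \ cut Y ζ)).Reachable d s) ↔ (∀ s ∈ S, ¬ (openGraph ζ).Reachable d s) :=
      forall₂_congr fun s _ => by rw [reachable_sdiff_cut_iff_of_avoid h s]
    rw [show (∀ s ∈ S, ¬ (openGraph (ζ \ cut Y ζ)).Reachable d s) = (∀ s ∈ S, ¬ (openGraph ζ).Reachable d s) from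
      propext this]
  -- the two test functions agree at every slot
  have hfun : (fun s' => chiO (openGraph (ζ \ cut Y ζ)).Reachable O (ℓ (setCl ζ Y)) S d s' - c s') =
      fun s' => ind (slotEv O d (S ∪ Y) s') ζ - c s' := by
    funext s'
    cases s' with
    | none =>
      rw [hℓ ζ, chiO_world_none, slotEv_none]
    | some w' =>
      rw [chiO_some, slotEv_some, ← chi_reachable_eq_ind ζ w' d]
      unfold CSH.chi
      rw [show ((openGraph (ζ \ cut Y ζ)).Reachable w' d) = ((openGraph ζ).Reachable w' d) from
        propext (reachable_world_iff_of_alive h w')]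
  rw [hfun, hav]

/-- Dead decoy: the world term is the CONFIGURATION-FREE number `−sl_{L'}[c](s)` (for `d ∉ S`, `d ∉ O`, `s ≠ some d` and `d` not among the
later decoys). (transcription of the cell memo png-dp-vplus MEMO-gen12.md §4(b)) [folklore] -/
theorem world_term_dead_set {ζ : Set (Sym2 V)} {Y : Set V} {d : V} (h : ζ ∉ avoidEv d Y) {O : Finset V} (hdO : d ∉ O) {S : Set V}
    (hdS : d ∉ S) (ℓ : ℝ) (L' : List (Option V × (Option V → ℝ))) (hL' : ∀ dc ∈ L', dc.1 ≠ some d) (c : Option V → ℝ)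
    {s : Option V} (hs : s ≠ some d) :
    av (openGraph (ζ \ cut Y ζ)).Reachable S d *
        slForm L' (fun s' => chiO (openGraph (ζ \ cut Y ζ)).Reachable O ℓ S d s' - c s') s = - slForm L' c s := by
  have hav : av (openGraph (ζ \ cut Y ζ)).Reachable S d = 1 := by
    unfold CSH.av
    rw [if_pos]
    intro s hs hr
    rw [SimpleGraph.reachable_comm, reachable_world_iff_of_dead h s] at hr
    exact hdS (hr ▸ hs)
  have hchi : ∀ s', s' ≠ some d → chiO (openGraph (ζ \ cut Y ζ)).Reachable O ℓ S d s' = 0 := by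
    intro s' hs'
    cases s' with
    | none =>
      rw [chiO_none]
      have : ¬ ((∃ o ∈ O, (openGraph (ζ \ cut Y ζ)).Reachable o d) ∧
          (∀ o ∈ O, ∀ s ∈ S, ¬ (openGraph (ζ \ cut Y ζ)).Reachable o s)) := by
        rintro ⟨⟨o, ho, hod⟩, -⟩
        exact hdO (((reachable_world_iff_of_dead h o).1 hod) ▸ ho)
      rw [if_neg this, mul_zero]
    | some w' =>
      rw [chiO_some]
      unfold CSH.chi
      rw [if_neg (fun hr => hs' (congrArg some ((reachable_world_iff_of_dead h w').1 hr)))]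
  have hsl : slForm L' (fun s' => chiO (openGraph (ζ \ cut Y ζ)).Reachable O ℓ S d s' - c s') s =
      slForm L' (fun s' => (-1 : ℝ) • c s') s := by
    refine slForm_congr L' ?_ fun dc hdc => ?_
    · rw [hchi s hs]; simp
    · rw [hchi dc.1 (hL' dc hdc)]; simp
  rw [hav, one_mul, hsl, show (fun s' => (-1 : ℝ) • c s') = (-1 : ℝ) • c from rfl, slForm_smul, Pi.smul_apply,
    smul_eq_mul]
  ring

variable [Fintype V]

/-! ### The moments of the residual against the slot indicators of a decoy -/

/-- **The moment of the residual against a slot indicator of the decoy, centred at the decoy constant** (set version of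
`CSH.sum_resid_decoy_moment`): with `E = {d ↮ A}` (`A ⊇ {x} ∪ Y`), `m₀ = μ(E) ≠ 0`, `m₁(s') = μ(E ∩ slotEv s')`, `c(s') = m₁(s')/m₀`,
`P₁(s') = Σ w 1_{E ∩ slotEv s'} Φ(C_d)`, `P₀ = Σ w 1_E Φ(C_d)`:
`Σ_ζ w Θ·1_E·(1_{slotEv s'} − c(s')) ≤ −m₀⁻¹·(m₀ P₁(s') − m₁(s') P₀)`, with EQUALITY on a vertex slot (`CSH.sum_resid_decoy_moment`) and the
inequality on the set slot from the defect lemma `CSH.sum_resid_obs_le`.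
[cite: VandenbergHaggstromKahn2005, §2.1 Lemma 2.4 (p. 10) — corollary] -/
theorem sum_resid_slot_moment_le (w : Sym2 V → ℝ) (hw0 : ∀ e, 0 ≤ w e) (hw1 : ∀ e, w e ≤ 1) (hm : ∑ ω, weight w ω = 1)
    (x : V) (Y : Set V) (g : Set (Sym2 V) → ℝ) (hg : Monotone g) (O : Finset V) (d : V) {A : Set V} (hA : insert x Y ⊆ A)
    (s' : Option V) {c : ℝ} (hm₀ : ∑ ζ, weight w ζ * ind (avoidEv d A) ζ ≠ 0)
    (hc : c = (∑ ζ, weight w ζ * ind (avoidEv d A ∩ slotEv O d A s') ζ) / ∑ ζ, weight w ζ * ind (avoidEv d A) ζ) :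
    ∑ ζ, weight w ζ * (resid w x Y g ζ * (ind (avoidEv d A) ζ * (ind (slotEv O d A s') ζ - c))) ≤
      - ((∑ ζ, weight w ζ * ind (avoidEv d A) ζ)⁻¹ *
          ((∑ ζ, weight w ζ * ind (avoidEv d A) ζ) *
              (∑ ζ, weight w ζ * (ind (avoidEv d A ∩ slotEv O d A s') ζ * phiS w x Y g d ζ)) -
            (∑ ζ, weight w ζ * ind (avoidEv d A ∩ slotEv O d A s') ζ) *
              (∑ ζ, weight w ζ * (ind (avoidEv d A) ζ * phiS w x Y g d ζ)))) := by
  cases s' with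
  | some w' =>
    simp only [slotEv_some]
    exact (sum_resid_decoy_moment w hm x Y g d hA w' hm₀ (by simpa only [slotEv_some] using hc)).le
  | none =>
    simp only [slotEv_none]
    set m₀ := ∑ ζ, weight w ζ * ind (avoidEv d A) ζ with hm₀'
    set m₁ := ∑ ζ, weight w ζ * ind (avoidEv d A ∩ obsEv O d A) ζ with hm₁'
    set P₁ := ∑ ζ, weight w ζ * (ind (avoidEv d A ∩ obsEv O d A) ζ * phiS w x Y g d ζ) with hP₁
    set P₀ := ∑ ζ, weight w ζ * (ind (avoidEv d A) ζ * phiS w x Y g d ζ) with hP₀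
    -- the two indicators of the observer event
    have hobs : ∀ ζ : Set (Sym2 V), ind (avoidEv d A) ζ * ind (obsEv O d A) ζ =
        ind {ζ : Set (Sym2 V) | ∃ o ∈ O, (openGraph ζ).Reachable o d} ζ *
          ind {ζ : Set (Sym2 V) | ∀ o ∈ O, ∀ a ∈ A, ¬ (openGraph ζ).Reachable o a} ζ := by
      intro ζ
      have hsub : obsEv O d A ⊆ avoidEv d A := obsEv_subset_avoid O d A
      by_cases h : ζ ∈ obsEv O d A
      · rw [ind_of_mem h, ind_of_mem (hsub h),
          ind_of_mem (show ζ ∈ {ζ : Set (Sym2 V) | ∃ o ∈ O, (openGraph ζ).Reachable o d} from h.1),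
          ind_of_mem (show ζ ∈ {ζ : Set (Sym2 V) | ∀ o ∈ O, ∀ a ∈ A, ¬ (openGraph ζ).Reachable o a} from h.2), one_mul]
      · rw [ind_of_not_mem h, mul_zero]
        by_cases h1 : ζ ∈ {ζ : Set (Sym2 V) | ∃ o ∈ O, (openGraph ζ).Reachable o d}
        · rw [ind_of_not_mem (show ζ ∉ {ζ : Set (Sym2 V) | ∀ o ∈ O, ∀ a ∈ A, ¬ (openGraph ζ).Reachable o a} from
            fun h2 => h ⟨h1, h2⟩), mul_zero]
        · rw [ind_of_not_mem h1, zero_mul]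
    have hobs' : ∀ ζ : Set (Sym2 V), ind (avoidEv d A ∩ obsEv O d A) ζ =
        ind {ζ : Set (Sym2 V) | ∃ o ∈ O, (openGraph ζ).Reachable o d} ζ *
          ind {ζ : Set (Sym2 V) | ∀ o ∈ O, ∀ a ∈ A, ¬ (openGraph ζ).Reachable o a} ζ := by
      intro ζ; rw [← hobs ζ, ind_inter]
    -- the defect lemma for the observer part, the point identity (with `f = 1`) for the constant part
    have h1 := sum_resid_obs_le w hw0 hw1 hm x Y g hg d hA O
    have h2 := sum_resid_mul_clusterFn w hm x Y g d hA (fun _ => (1 : ℝ))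
    simp only [mul_one] at h2
    have hP₁' : P₁ = ∑ ζ, weight w ζ * (ind {ζ : Set (Sym2 V) | ∃ o ∈ O, (openGraph ζ).Reachable o d} ζ *
        ind {ζ : Set (Sym2 V) | ∀ o ∈ O, ∀ a ∈ A, ¬ (openGraph ζ).Reachable o a} ζ * phiS w x Y g d ζ) := by
      rw [hP₁]; exact Finset.sum_congr rfl fun ζ _ => by rw [hobs' ζ]
    have e : ∑ ζ, weight w ζ * (resid w x Y g ζ * (ind (avoidEv d A) ζ * (ind (obsEv O d A) ζ - c))) =
        ∑ ζ, weight w ζ * (resid w x Y g ζ * (ind {ζ : Set (Sym2 V) | ∃ o ∈ O, (openGraph ζ).Reachable o d} ζ *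
          ind {ζ : Set (Sym2 V) | ∀ o ∈ O, ∀ a ∈ A, ¬ (openGraph ζ).Reachable o a} ζ)) -
        c * ∑ ζ, weight w ζ * (resid w x Y g ζ * (ind (avoidEv d A) ζ)) := by
      rw [Finset.mul_sum, ← Finset.sum_sub_distrib]
      exact Finset.sum_congr rfl fun ζ _ => by rw [← hobs ζ]; ring
    rw [e, h2]
    rw [← hP₁'] at h1
    have hc' : c * m₀ = m₁ := by
      rw [hc]; exact div_mul_cancel₀ _ hm₀
    have hP0' : ∑ ζ, weight w ζ * (ind (avoidEv d A) ζ * phiS w x Y g d ζ) = P₀ := rfl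
    rw [hP0']
    have key : -(m₀⁻¹ * (m₀ * P₁ - m₁ * P₀)) = -P₁ + c * P₀ := by
      rw [← hc']; field_simp; ring
    rw [key]
    linarith


end CSHSet

end Summit.CriticalPhenomena.PercolationContinuityZ3.Theorems

end
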